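import Summits.AtomisticToContinuum.Crystallization.Theorems.FreeSplittingCertificatesStrictSplittingRuleP1FarCellTail12

/-!
# `StrictSplittingRule` (stmt-AtomisticToContinuum-12560): AUDIT of the endpoint's reach-table hypothesis — the pinned `(TAB)` of parts 79–103 is UNSATISFIABLE (unit mismatch), and the REPAIRED endpoint with the radial table normalised by `‖y_q − y_p‖²` (P1 interpolant object, part 104)

Route `FreeSplittingCertificates`, crux r3 `StrictSplittingRule` (H12⋆ = `stub_coreJointCoercive`), unit b2b-freesplit-B gen 41.
VALUE = an AUDIT FINDING made kernel-checkable + its repair (HOME CERT §40).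

**The finding.**  The certified reach table `p1LU = (L, U)` (parts 77/78, transcribed verbatim from `matched34cert.json`) carries `L` in the
CERTIFICATES' convention: `farval.py` certifies `L_q ≤ κ(19/8)/⟨ŷ, I_rad,q⁻¹ ŷ⟩`, i.e. `L_q·⟨ŷ_q, v⟩² ≤ H_rad,q(v)` with the UNIT vector
`ŷ_q = (y_q − y_p)/‖y_q − y_p‖`, and the near certificate `nearcert.py` (v9/v10) books the far radial coverage as `(L_q / s_q)·⟨y_q − y_p, v⟩²`
(`s_q = ‖y_q − y_p‖²`).  The kernel statements (TAB) and (NC∃) of `coreJointCoercive_cell_of_certificates₈ … ₁₄` multiply `L_q` by the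
UN-normalised `p1NRad a h p V q ² = ⟨y_q − y_p, V q⟩²` instead.  Consequences: (i) hypothesis (TAB) as stated is FALSE on the whole
`HcpFamilyMin` box — `reachTable_tab_unsatisfiable` below refutes it at `p = 0`, `q = (−7,−1,0)`, `z = y_q` (`L·s² = 2.4·10⁻³ s⁻²·…` against
`H_rad(z) ≤ κ(19/8)·V·s·((3/4)s − 4a² − 3h²)⁻⁴`) — so the endpoints `…₈ … ₁₄` are VACUOUSLY true and were never dischargeable;
(ii) hypothesis (NC∃) as stated is weaker than (implied by) what v10 certified (extra radial credit `(s_q − 1)·L_q·⟨ŷ,V⟩² ≥ 0`), so it was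
not wrong, only mismatched.  Nothing in the kernel was false; the DATA were attached in the wrong units.
**The repair.**  `coreJointCoercive_cell_of_certificates₁₅`: part 103's endpoint `…₁₄` with `L` replaced by `L_q/‖y_q − y_p‖²` in BOTH
places — (TAB') is then literally farval's certified statement and (NC∃') literally nearcert's form; proved from the table-parametric
endpoint `coreJointCoercive_cell_of_certificates₇` (part 76) and the tail lemmas of parts 83/93/97/103 (`farSite_domination`,
`payColumn_le_of_near`, `defect_only_budget`, `farCell_budget12`).  The other three hypotheses are verbatim.
* `p1TabA_neg7_neg1_0`, `mem_p1QB_neg7_neg1_0` (table lookups by evaluation); **`reachTable_tab_unsatisfiable`**;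
* **`coreJointCoercive_cell_of_certificates₁₅`**.
NOT a proof of H12⋆ (the five finite hypotheses are verified outside the kernel), NOT summit progress.  [folklore]
-/

noncomputable section

open Set Function Metric MeasureTheory Filter Topology
open scoped BigOperators NNReal ENNReal Classical

namespace Summit.AtomisticToContinuum.Crystallization.Theorems.StrictSplittingRuleBirth

open Literature.MathematicalPhysics.StatisticalMechanics
open Summit.AtomisticToContinuum.Crystallization.Theorems.PalmUnimodularRigidity.LayeredLawsSelectHcp

/-! ## The table entry and the reach-set membership of the witness site `(−7,−1,0)` (parity A) -/

set_option maxRecDepth 16384 in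
/-- The certified reach table of parity A at the offset `(−7,−1,0)` (first key of chunk 0): `L = 30975169629/1.25·10¹⁶ ≈ 2.478·10⁻⁶`,
`U = 106311162197/5·10¹⁷`. -/
theorem p1TabA_neg7_neg1_0 :
    p1TabA (-7, -1, 0) = ((30975169629 : ℝ) / 12500000000000000, (106311162197 : ℝ) / 500000000000000000) := by
  simp [p1TabA, p1TabA0, p1TabA1, p1TabA2, p1TabA3, p1TabA4, p1TabA5, p1TabA6, p1TabA7, p1TabA8, p1TabA9, p1TabA10,
    p1TabA11, p1TabA12, p1TabA13, p1TabA14, p1TabA15, p1TabA16, p1TabA17, p1TabA18, p1TabA19]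

/-- The witness site `(−7,−1,0)` lies in the reach set of the representative `p = 0`. -/
theorem mem_p1QB_neg7_neg1_0 : ((-7, -1, 0) : ℤ × ℤ × ℤ) ∈ p1QB (0, 0, 0) := by
  simp [p1QB, p1SiteBox, p1IsKeyA, p1IsKeyA0]

/-! ## (TAB) as pinned in parts 79–103 is unsatisfiable -/

set_option maxRecDepth 8192 in
/-- **AUDIT FINDING (kernel-checked): hypothesis (TAB) of `coreJointCoercive_cell_of_certificates₈ … ₁₄` is FALSE on the whole box.**
At `p = 0`, `q = (−7,−1,0)` (`s = ‖y_q‖² = a²/3 + 49h² ≈ 31.1`) and `z = y_q`: the left side is `L·s²` with the pinned `L ≈ 2.478·10⁻⁶`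
(a bound certified against the NORMALISED radial component), whereas the hat-averaged radial share is at most
`κ(19/8)·s·V·((3/4)s − 4a² − 3h²)⁻⁴` (`V = √3a²h/2`; Cauchy–Schwarz `q_W(z) ≤ κ(19/8)χ²|x|⁻⁸|z|²`, `χ² ≤ 1`, and `|x|² ≥ (3/4)s − 3|e|²` on the
star, `|e|² ≤ 4a²/3 + h²`): `L·s·((3/4)s − 4a² − 3h²)⁴ ≥ 6 > 2.38 ≥ κ(19/8)V`.  So the conditional endpoints `…₈ … ₁₄` were vacuous; see
`coreJointCoercive_cell_of_certificates₁₅` for the repaired statement.  NOT a proof of H12⋆, NOT summit progress. -/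
theorem reachTable_tab_unsatisfiable {a h : ℝ} (ha : 0 < a) (hh : 0 < h) (hfam : HcpFamilyMin a h) :
    ¬ (∀ p ∈ ({(0, 0, 0), (1, 0, 0)} : Finset (ℤ × ℤ × ℤ)), ∀ q ∈ p1QB p, q ≠ p → ∀ z : Fin 3 → ℝ,
      (p1LU p q).1 * p1NRad a h p (fun _ => z) q ^ 2 ≤
        p1SiteBare a h (fun y k l => (193 / 125) * ((7 * (5 / 4 : ℝ) + 3 / 4) / 4) * fpChi ((81 / 20 * a) ^ 2) ((27 / 5 * a) ^ 2) (y - fun k => hcpSite a h p k) ^ 2 *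
          (fpSq (y - fun k => hcpSite a h p k))⁻¹ ^ 5 * ((y - fun k => hcpSite a h p k) k * (y - fun k => hcpSite a h p k) l)) (fun _ => z) q ∧
      p1SiteBare a h (fun y k l => (193 / 125) * ((3 / 4 : ℝ) / 4) * fpChi ((81 / 20 * a) ^ 2) ((27 / 5 * a) ^ 2) (y - fun k => hcpSite a h p k) ^ 2 *
          (fpSq (y - fun k => hcpSite a h p k))⁻¹ ^ 4 * (if k = l then 1 else 0)) (fun _ => z) q ≤ (p1LU p q).2 * fpSq z) := by
  intro hTab
  -- the box
  obtain ⟨hA, hH⟩ := hcpFamilyMin_enclosure ha hh hfam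
  rw [abs_sub_le_iff] at hA hH
  obtain ⟨hA1, hA2⟩ := hA
  obtain ⟨hH1, hH2⟩ := hH
  obtain ⟨h3lo, h3hi⟩ := sqrt_three_bounds
  have ha_lo : 0.97119 ≤ a := by linarith
  have ha_hi : a ≤ 0.97139 := by linarith
  have hh_lo : 0.79284 ≤ h := by linarith
  have hh_hi : h ≤ 0.79304 := by linarith
  have h3 : √3 ^ 2 = 3 := Real.sq_sqrt (by norm_num)
  have hs3 : (0 : ℝ) ≤ √3 := Real.sqrt_nonneg 3
  -- numerics on the box: `s = ‖y_q‖²`, `m = (3/4)s − 4a² − 3h²`, `V ≤ 0.64808`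
  obtain ⟨s, hs_def⟩ : ∃ s : ℝ, s = a ^ 2 / 3 + 49 * h ^ 2 := ⟨_, rfl⟩
  have hs_lo : 31 ≤ s := by rw [hs_def]; nlinarith
  have hs0 : 0 < s := by linarith
  obtain ⟨m, hm_def⟩ : ∃ m : ℝ, m = 3 / 4 * s - 4 * a ^ 2 - 3 * h ^ 2 := ⟨_, rfl⟩
  have hm_lo : 17 ≤ m := by rw [hm_def]; nlinarith
  have hm0 : 0 < m := by linarith
  have hc : (0 : ℝ) ≤ (193 / 125) * ((7 * (5 / 4 : ℝ) + 3 / 4) / 4) := by norm_num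
  have hW0 : 0 ≤ a ^ 2 * h := by positivity
  have hW : a ^ 2 * h ≤ 0.74832 :=
    calc a ^ 2 * h ≤ 0.97139 ^ 2 * 0.79304 :=
          mul_le_mul (pow_le_pow_left₀ ha.le ha_hi 2) hh_hi hh.le (by norm_num)
      _ ≤ 0.74832 := by norm_num
  have hV : √3 * a ^ 2 * h / 2 ≤ 0.64808 := by
    have := mul_le_mul h3hi hW hW0 (by norm_num)
    nlinarith
  have hV0 : 0 ≤ √3 * a ^ 2 * h / 2 := by positivity
  have hm4 : (17 : ℝ) ^ 4 ≤ m ^ 4 := pow_le_pow_left₀ (by norm_num) hm_lo 4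
  have hminv : (m⁻¹) ^ 4 ≤ ((17 : ℝ) ^ 4)⁻¹ := by
    rw [inv_pow]; exact inv_anti₀ (by norm_num) hm4
  have hKle : (193 / 125) * ((7 * (5 / 4 : ℝ) + 3 / 4) / 4) * (m⁻¹) ^ 4 * s ≤
      (193 / 125) * ((7 * (5 / 4 : ℝ) + 3 / 4) / 4) * ((17 : ℝ) ^ 4)⁻¹ * s :=
    mul_le_mul_of_nonneg_right (mul_le_mul_of_nonneg_left hminv hc) hs0.le
  have hKV : (193 / 125) * ((7 * (5 / 4 : ℝ) + 3 / 4) / 4) * (m⁻¹) ^ 4 * s * (√3 * a ^ 2 * h / 2) ≤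
      (193 / 125) * ((7 * (5 / 4 : ℝ) + 3 / 4) / 4) * ((17 : ℝ) ^ 4)⁻¹ * s * 0.64808 :=
    mul_le_mul hKle hV hV0 (by positivity)
  have hnum : (193 / 125) * ((7 * (5 / 4 : ℝ) + 3 / 4) / 4) * ((17 : ℝ) ^ 4)⁻¹ * s * 0.64808 <
      (30975169629 : ℝ) / 12500000000000000 * s ^ 2 := by
    nlinarith [mul_le_mul_of_nonneg_left hs_lo hs0.le]
  -- the witness `p = 0`, `q = (−7,−1,0)`, `z = d = y_q − y_p`
  have hp : ((0, 0, 0) : ℤ × ℤ × ℤ) ∈ ({(0, 0, 0), (1, 0, 0)} : Finset (ℤ × ℤ × ℤ)) := by simp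
  have hqp : ((-7, -1, 0) : ℤ × ℤ × ℤ) ≠ (0, 0, 0) := by decide
  obtain ⟨d, hd_def⟩ : ∃ d : Fin 3 → ℝ,
      d = fun k => hcpSite a h ((-7, -1, 0) : ℤ × ℤ × ℤ) k - hcpSite a h ((0, 0, 0) : ℤ × ℤ × ℤ) k := ⟨_, rfl⟩
  have hl7 : (haggLabel alternatingHagg (-7) : ℝ) = 1 := by
    rw [haggLabel_alternating_of_odd (by decide)]; simp
  have hl0 : (haggLabel alternatingHagg 0 : ℝ) = 0 := by
    rw [haggLabel_alternating_of_even (by decide)]; simp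
  have hd0 : d 0 = -(a / 2) := by
    have e1 := hcpSite_apply_zero a h ((-7, -1, 0) : ℤ × ℤ × ℤ)
    have e2 := hcpSite_apply_zero a h ((0, 0, 0) : ℤ × ℤ × ℤ)
    simp only at e1 e2
    rw [hd_def]
    dsimp only
    rw [e1, e2, hl7, hl0]
    push_cast
    ring
  have hd1 : d 1 = a * √3 / 6 := by
    have e1 := hcpSite_apply_one a h ((-7, -1, 0) : ℤ × ℤ × ℤ)
    have e2 := hcpSite_apply_one a h ((0, 0, 0) : ℤ × ℤ × ℤ)
    simp only at e1 e2
    rw [hd_def]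
    dsimp only
    rw [e1, e2, hl7, hl0]
    push_cast
    ring
  have hd2 : d 2 = -(7 * h) := by
    have e1 := hcpSite_apply_two a h ((-7, -1, 0) : ℤ × ℤ × ℤ)
    have e2 := hcpSite_apply_two a h ((0, 0, 0) : ℤ × ℤ × ℤ)
    simp only at e1 e2
    rw [hd_def]
    dsimp only
    rw [e1, e2]
    push_cast
    ring
  have hds : fpSq d = s := by
    rw [hs_def]
    simp only [fpSq, hd0, hd1, hd2]
    linear_combination (a ^ 2 / 36) * h3
  have hdd : d 0 ^ 2 + d 1 ^ 2 + d 2 ^ 2 = s := by rw [← hds]; rfl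
  have hL : (p1LU (0, 0, 0) (-7, -1, 0)).1 = (30975169629 : ℝ) / 12500000000000000 := by
    have e : p1LU (0, 0, 0) (-7, -1, 0) = p1TabA (-7, -1, 0) := by
      simp only [p1LU, if_true]
      rfl
    rw [e, p1TabA_neg7_neg1_0]
  have hNR : p1NRad a h (0, 0, 0) (fun _ => d) (-7, -1, 0) = s := by
    rw [← hds, hd_def]; simp only [p1NRad, fpSq, Fin.sum_univ_three]; ring
  -- the instance of (TAB) at the witness (radial half)
  have hinst := (hTab (0, 0, 0) hp (-7, -1, 0) mem_p1QB_neg7_neg1_0 hqp d).1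
  rw [hL, hNR] at hinst
  -- an upper bound of the hat-averaged radial share at the constant value `d`
  have hS1 : (0 : ℝ) < (81 / 20 * a) ^ 2 := by positivity
  have hS12 : (81 / 20 * a) ^ 2 < (27 / 5 * a) ^ 2 := by nlinarith
  have hup : p1SiteBare a h (fun y k l => (193 / 125) * ((7 * (5 / 4 : ℝ) + 3 / 4) / 4) *
        fpChi ((81 / 20 * a) ^ 2) ((27 / 5 * a) ^ 2) (y - fun k => hcpSite a h ((0, 0, 0) : ℤ × ℤ × ℤ) k) ^ 2 *
        (fpSq (y - fun k => hcpSite a h ((0, 0, 0) : ℤ × ℤ × ℤ) k))⁻¹ ^ 5 *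
        ((y - fun k => hcpSite a h ((0, 0, 0) : ℤ × ℤ × ℤ) k) k * (y - fun k => hcpSite a h ((0, 0, 0) : ℤ × ℤ × ℤ) k) l))
        (fun _ => d) (-7, -1, 0) ≤
      (193 / 125) * ((7 * (5 / 4 : ℝ) + 3 / 4) / 4) * (m⁻¹) ^ 4 * s * (√3 * a ^ 2 * h / 2) := by
    rw [p1SiteBare_const_eq_star]
    have hf : Continuous fun y : Fin 3 → ℝ => p1Quad3 (fun k l => (193 / 125) * ((7 * (5 / 4 : ℝ) + 3 / 4) / 4) *
        fpChi ((81 / 20 * a) ^ 2) ((27 / 5 * a) ^ 2) (y - fun k => hcpSite a h ((0, 0, 0) : ℤ × ℤ × ℤ) k) ^ 2 *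
        (fpSq (y - fun k => hcpSite a h ((0, 0, 0) : ℤ × ℤ × ℤ) k))⁻¹ ^ 5 *
        ((y - fun k => hcpSite a h ((0, 0, 0) : ℤ × ℤ × ℤ) k) k * (y - fun k => hcpSite a h ((0, 0, 0) : ℤ × ℤ × ℤ) k) l)) d :=
      continuous_p1Quad3_of_continuous
        (fun k l => continuous_radWeight_translate hS1 hS12 _ (fun k => hcpSite a h ((0, 0, 0) : ℤ × ℤ × ℤ) k) k l)
        (fun k => continuous_const)
    have hg : Continuous fun y : Fin 3 → ℝ => (193 / 125) * ((7 * (5 / 4 : ℝ) + 3 / 4) / 4) * (m⁻¹) ^ 4 * s +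
        fpDot (fun _ => (0 : ℝ)) (fun k => y k - hcpSite a h ((-7, -1, 0) : ℤ × ℤ × ℤ) k) +
        p1Quad3 (fun _ _ => (0 : ℝ)) (fun k => y k - hcpSite a h ((-7, -1, 0) : ℤ × ℤ × ℤ) k) := by
      simp only [fpDot, p1Quad3_eq]
      fun_prop
    have hmono := p1Star_setIntegral_mono ha hh ((-7, -1, 0) : ℤ × ℤ × ℤ) hf hg (fun o ho π m' hv y hy => by
      have he : fpSq (fun k => y k - hcpSite a h ((-7, -1, 0) : ℤ × ℤ × ℤ) k) ≤ 4 * a ^ 2 / 3 + h ^ 2 :=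
        fpSq_sub_le_of_mem_starCell ha.ne' hh.ne' _ ho hv hy
      have hx : (y - fun k => hcpSite a h ((0, 0, 0) : ℤ × ℤ × ℤ) k) = d + fun k => y k - hcpSite a h ((-7, -1, 0) : ℤ × ℤ × ℤ) k := by
        funext k; simp [hd_def]
      have h0 : fpDot (fun _ => (0 : ℝ)) (fun k => y k - hcpSite a h ((-7, -1, 0) : ℤ × ℤ × ℤ) k) +
          p1Quad3 (fun _ _ => (0 : ℝ)) (fun k => y k - hcpSite a h ((-7, -1, 0) : ℤ × ℤ × ℤ) k) = 0 := by
        simp [fpDot, p1Quad3]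
      rw [add_assoc, h0, add_zero, hx]
      refine (p1Quad3_radWeight_le hc _ _ _ d).trans ?_
      rw [hdd]
      have hχ := fpChi_sq_le_one ((81 / 20 * a) ^ 2) ((27 / 5 * a) ^ 2) (d + fun k => y k - hcpSite a h ((-7, -1, 0) : ℤ × ℤ × ℤ) k)
      -- `|x|² ≥ (3/4)s − 3|e|² ≥ m`
      have hlow : m ≤ fpSq (d + fun k => y k - hcpSite a h ((-7, -1, 0) : ℤ × ℤ × ℤ) k) := by
        have hsq : 0 ≤ fpSq (fun k => d k / 2 + 2 * (y k - hcpSite a h ((-7, -1, 0) : ℤ × ℤ × ℤ) k)) := fpSq_nonneg _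
        have hexp : fpSq (fun k => d k / 2 + 2 * (y k - hcpSite a h ((-7, -1, 0) : ℤ × ℤ × ℤ) k)) =
            fpSq d / 4 + 2 * fpDot d (fun k => y k - hcpSite a h ((-7, -1, 0) : ℤ × ℤ × ℤ) k) +
              4 * fpSq (fun k => y k - hcpSite a h ((-7, -1, 0) : ℤ × ℤ × ℤ) k) := by
          simp only [fpSq, fpDot]; ring
        rw [fpSq_add_eq, hds]
        rw [hexp, hds] at hsq
        rw [hm_def]
        linarith
      have hxpos : 0 < fpSq (d + fun k => y k - hcpSite a h ((-7, -1, 0) : ℤ × ℤ × ℤ) k) := lt_of_lt_of_le hm0 hlow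
      have hinv : (fpSq (d + fun k => y k - hcpSite a h ((-7, -1, 0) : ℤ × ℤ × ℤ) k))⁻¹ ≤ m⁻¹ := inv_anti₀ hm0 hlow
      have hinv4 : (fpSq (d + fun k => y k - hcpSite a h ((-7, -1, 0) : ℤ × ℤ × ℤ) k))⁻¹ ^ 4 ≤ (m⁻¹) ^ 4 :=
        pow_le_pow_left₀ (inv_nonneg.2 hxpos.le) hinv 4
      calc (193 / 125) * ((7 * (5 / 4 : ℝ) + 3 / 4) / 4) *
            fpChi ((81 / 20 * a) ^ 2) ((27 / 5 * a) ^ 2) (d + fun k => y k - hcpSite a h ((-7, -1, 0) : ℤ × ℤ × ℤ) k) ^ 2 *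
            (fpSq (d + fun k => y k - hcpSite a h ((-7, -1, 0) : ℤ × ℤ × ℤ) k))⁻¹ ^ 4 * s
          ≤ (193 / 125) * ((7 * (5 / 4 : ℝ) + 3 / 4) / 4) * 1 * (m⁻¹) ^ 4 * s := by gcongr
        _ = (193 / 125) * ((7 * (5 / 4 : ℝ) + 3 / 4) / 4) * (m⁻¹) ^ 4 * s := by rw [mul_one])
    refine hmono.trans ?_
    rw [p1Star_setIntegral_poly ha hh ((-7, -1, 0) : ℤ × ℤ × ℤ) _ (fun _ => (0 : ℝ)) (fun _ _ => (0 : ℝ))]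
    simp
  -- the contradiction
  exact absurd (hnum.trans_le (hinst.trans hup)) (not_lt.2 hKV)

/-! ## The repaired endpoint: the radial reach table normalised by `‖y_q − y_p‖²` -/

/-- **H12⋆ ON THE BOX FROM FIVE CLOSED, FINITE CERTIFICATE STATEMENTS — REPAIRED UNITS OF THE RADIAL REACH TABLE.**  Part 103's
`coreJointCoercive_cell_of_certificates₁₄` with the pinned radial table entry `L_q = (p1LU p q).1` DIVIDED by `‖y_q − y_p‖²` wherever it
multiplies `p1NRad a h p · q ² = ⟨y_q − y_p, ·⟩²`: in (TAB') (`(L_q/‖d_q‖²)·⟨d_q,z⟩² ≤ H_rad,q(z)`, i.e. `L_q·⟨ŷ_q,z⟩² ≤ H_rad,q(z)` —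
literally the statement farval.py certifies) and in the near form of (NC∃') (radial coverage `(L_q/s_q)·⟨d_q,V_q⟩²` — literally nearcert.py's
bare term).  (B∃_fin, 12a), (S_fin), (PAY_near) verbatim.  Proof: the table-parametric endpoint `coreJointCoercive_cell_of_certificates₇`
(part 76) at `L := fun p q => (p1LU p q).1/‖y_q − y_p‖²`, `U := fun p q => (p1LU p q).2`, with the tails discharged by `farSite_domination`
(part 83), `payColumn_le_of_near` (part 93), `defect_only_budget` (part 97) and `farCell_budget12` (part 103).
NOT a proof of H12⋆ (the five finite hypotheses are verified outside the kernel), NOT summit progress. -/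
theorem coreJointCoercive_cell_of_certificates₁₅ {a h : ℝ} (ha : 0 < a) (hh : 0 < h) (hfam : HcpFamilyMin a h)
    -- (B∃_fin, 12a) THE PER-CELL BUDGET at each representative FOR SOME allocation tables that follow the EXACT RULE on the cells ≥ 12a away, asked only for the FINITELY MANY cells of the 12a cell box with a vertex within 12a THAT CARRY LOAD under the tables
    (hB : ∀ p ∈ ({(0, 0, 0), (1, 0, 0)} : Finset (ℤ × ℤ × ℤ)),
      ∃ θ θv : (ℤ × ℤ × ℤ) × (ℤ × ℤ × ℤ) → (ℤ × ℤ × ℤ) × Fin 6 → ℝ,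
        (∀ e T, 0 ≤ θ e T) ∧ (∀ e, (Function.support (θ e)).Finite) ∧ (∀ T, (Function.support fun e => θ e T).Finite) ∧
        (∀ e, p1FarW a h (p1Phi0 p) p e ≠ 0 → ∑ᶠ T, θ e T = 1) ∧
        (∀ e T, θ e T ≠ 0 → ∃ m m' : Fin 4, e.1 = T.1 + p1VertOff (p1Par T.1) T.2 m ∧
          e.1 + e.2 = T.1 + p1VertOff (p1Par T.1) T.2 m') ∧
        (∀ e T, 0 ≤ θv e T) ∧ (∀ e, (Function.support (θv e)).Finite) ∧ (∀ T, (Function.support fun e => θv e T).Finite) ∧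
        (∀ e, (∑ i : Fin 3, (2 / 3) * ((if e.2 = p1RouteOff e.1 i then p1FarWv a h (p1Phi0 p) p e.1 else 0) +
          (if p1RouteOff (e.1 - (p1SV - e.2)) i = p1SV - e.2 then p1FarWv a h (p1Phi0 p) p (e.1 - (p1SV - e.2)) else 0))) ≠ 0 → ∑ᶠ T, θv e T = 1) ∧
        (∀ e T, θv e T ≠ 0 → ∃ m m' : Fin 4, e.1 = T.1 + p1VertOff (p1Par T.1) T.2 m ∧
          e.1 + e.2 = T.1 + p1VertOff (p1Par T.1) T.2 m') ∧
        (∀ T : (ℤ × ℤ × ℤ) × Fin 6, (∀ m : Fin 4, 12 * a ≤ ‖hcpSite a h (T.1 + p1VertOff (p1Par T.1) T.2 m) - hcpSite a h p‖) →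
          ∀ e, θ e T = p1ThetaX a h p e T ∧ θv e T = p1ThetaX a h p e T) ∧
        ∀ (T : (ℤ × ℤ × ℤ) × Fin 6), T.1 ∈ p1CellBox12 p →
          (∃ m : Fin 4, ‖hcpSite a h (T.1 + p1VertOff (p1Par T.1) T.2 m) - hcpSite a h p‖ < 12 * a) → (∃ e, θ e T ≠ 0 ∨ θv e T ≠ 0) →
          ∀ (G : Fin 3 → Fin 3 → ℝ),
      (∑ᶠ e : (ℤ × ℤ × ℤ) × (ℤ × ℤ × ℤ), θ e T * p1FarW a h (p1Phi0 p) p e *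
          fpSq (fun k => (hcpSite a h (e.1 + e.2) 0 - hcpSite a h e.1 0) * G 0 k +
            (hcpSite a h (e.1 + e.2) 1 - hcpSite a h e.1 1) * G 1 k + (hcpSite a h (e.1 + e.2) 2 - hcpSite a h e.1 2) * G 2 k)) +
      (∑ᶠ e : (ℤ × ℤ × ℤ) × (ℤ × ℤ × ℤ), θv e T *
          (∑ i : Fin 3, (2 / 3) * ((if e.2 = p1RouteOff e.1 i then p1FarWv a h (p1Phi0 p) p e.1 else 0) +
            (if p1RouteOff (e.1 - (p1SV - e.2)) i = p1SV - e.2 then p1FarWv a h (p1Phi0 p) p (e.1 - (p1SV - e.2)) else 0))) *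
          fpSq (fun k => (hcpSite a h (e.1 + e.2) 0 - hcpSite a h e.1 0) * G 0 k +
            (hcpSite a h (e.1 + e.2) 1 - hcpSite a h e.1 1) * G 1 k + (hcpSite a h (e.1 + e.2) 2 - hcpSite a h e.1 2) * G 2 k)) +
      p1CellDefectG a h (fun y k l => (193 / 125) * ((7 * (5 / 4 : ℝ) + 3 / 4) / 4) * fpChi ((81 / 20 * a) ^ 2) ((27 / 5 * a) ^ 2) (y - fun k => hcpSite a h p k) ^ 2 *
          (fpSq (y - fun k => hcpSite a h p k))⁻¹ ^ 5 * ((y - fun k => hcpSite a h p k) k * (y - fun k => hcpSite a h p k) l)) T G ≤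
      (193 / 125) * ((5 / 2 * (1 / 24 * fpSymSq G) + 5 / 2 * (1 / 24 * (fpFrob G - fpSymSq G))) *
        ∫ y in p1RealCell a h T, fpChi ((81 / 20 * a) ^ 2) ((27 / 5 * a) ^ 2) (y - fun k => hcpSite a h p k) ^ 2 * (fpSq (y - fun k => hcpSite a h p k))⁻¹ ^ 3))
    -- (S_fin) per-site domination off the PINNED reach set at the FINITELY MANY sites of the 20a index box with `‖y_q − y_p‖ < 20a`; (TAB') the PINNED certified tables, `L` NORMALISED by `‖y_q − y_p‖²` (the certificates' convention)
    (hS : ∀ p ∈ ({(0, 0, 0), (1, 0, 0)} : Finset (ℤ × ℤ × ℤ)),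
      ∀ q ∈ Finset.Icc (p.1 - 26) (p.1 + 26) ×ˢ (Finset.Icc (p.2.1 - 34) (p.2.1 + 34) ×ˢ Finset.Icc (p.2.2 - 23) (p.2.2 + 23)),
      q ∉ p1QB p → q ≠ p → ‖hcpSite a h q - hcpSite a h p‖ < 20 * a → ∀ z : Fin 3 → ℝ,
      0 ≤ 1 / 2 * (ljSqDeriv (‖hcpSite a h q - hcpSite a h p‖ ^ 2) * fpSq z +
          2 * (1 / 2 * (7 * ((‖hcpSite a h q - hcpSite a h p‖ ^ 2)⁻¹) ^ 8 -
            4 * ((‖hcpSite a h q - hcpSite a h p‖ ^ 2)⁻¹) ^ 5)) * p1NRad a h p (fun _ => z) q ^ 2) +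
        p1SiteBare a h (fun y k l => (193 / 125) * ((7 * (5 / 4 : ℝ) + 3 / 4) / 4) * fpChi ((81 / 20 * a) ^ 2) ((27 / 5 * a) ^ 2) (y - fun k => hcpSite a h p k) ^ 2 *
          (fpSq (y - fun k => hcpSite a h p k))⁻¹ ^ 5 * ((y - fun k => hcpSite a h p k) k * (y - fun k => hcpSite a h p k) l)) (fun _ => z) q -
        p1SiteBare a h (fun y k l => (193 / 125) * ((3 / 4 : ℝ) / 4) * fpChi ((81 / 20 * a) ^ 2) ((27 / 5 * a) ^ 2) (y - fun k => hcpSite a h p k) ^ 2 *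
          (fpSq (y - fun k => hcpSite a h p k))⁻¹ ^ 4 * (if k = l then 1 else 0)) (fun _ => z) q)
    (hTab : ∀ p ∈ ({(0, 0, 0), (1, 0, 0)} : Finset (ℤ × ℤ × ℤ)), ∀ q ∈ p1QB p, q ≠ p → ∀ z : Fin 3 → ℝ,
      (p1LU p q).1 / ‖hcpSite a h q - hcpSite a h p‖ ^ 2 * p1NRad a h p (fun _ => z) q ^ 2 ≤
        p1SiteBare a h (fun y k l => (193 / 125) * ((7 * (5 / 4 : ℝ) + 3 / 4) / 4) * fpChi ((81 / 20 * a) ^ 2) ((27 / 5 * a) ^ 2) (y - fun k => hcpSite a h p k) ^ 2 *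
          (fpSq (y - fun k => hcpSite a h p k))⁻¹ ^ 5 * ((y - fun k => hcpSite a h p k) k * (y - fun k => hcpSite a h p k) l)) (fun _ => z) q ∧
      p1SiteBare a h (fun y k l => (193 / 125) * ((3 / 4 : ℝ) / 4) * fpChi ((81 / 20 * a) ^ 2) ((27 / 5 * a) ^ 2) (y - fun k => hcpSite a h p k) ^ 2 *
          (fpSq (y - fun k => hcpSite a h p k))⁻¹ ^ 4 * (if k = l then 1 else 0)) (fun _ => z) q ≤ (p1LU p q).2 * fpSq z)
    -- (PAY_near) the far table's column sums over the FINITELY MANY sites of the 44a box WITHIN 44a of y_p, by the PINNED payments minus the kernel's far allowance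
    (hPAY : ∀ p ∈ ({(0, 0, 0), (1, 0, 0)} : Finset (ℤ × ℤ × ℤ)), ∀ s ∈ p1BondOffsets, (193 / 125) * (2 / 5) / a ^ 4 *
      (∑ q ∈ Finset.Icc (p.1 - 53) (p.1 + 53) ×ˢ (Finset.Icc (p.2.1 - 69) (p.2.1 + 69) ×ˢ Finset.Icc (p.2.2 - 51) (p.2.2 + 51)),
        if ‖hcpSite a h q - hcpSite a h p‖ < 44 * a then
          p1RecTable a h (p1SplitDensity (81 / 20 * a) (27 / 5 * a)) (decide (Even p.1)) (q - p) s else 0) ≤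
      p1Paym p s - 3 / 200000 * p1BondW (fun _ => (1 : ℝ)) p s)
    -- (NC∃') THE NEAR CERTIFICATE WITH THE EXACT COLLAR FLUX at both representatives, FOR SOME stencilled decaying finitely supported near tables — radial table `L` NORMALISED by `‖y_q − y_p‖²` (nearcert.py's `Lq / s2`)
    (hNC : ∃ M₁ N : Bool → (ℤ × ℤ × ℤ) → (ℤ × ℤ × ℤ) → (ℤ × ℤ × ℤ) → ℝ, ∃ QT : (ℤ × ℤ × ℤ) → Finset (ℤ × ℤ × ℤ),
      (∀ b d s s', s ∉ p1BondOffsets ∨ s' ∉ p1BondOffsets → M₁ b d s s' = 0 ∧ N b d s s' = 0) ∧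
      (∃ C₁ : ℝ, ∀ p q : ℤ × ℤ × ℤ, ∀ s s', |M₁ (decide (Even p.1)) (q - p) s s'| ≤
        C₁ * ((1 + ‖hcpSite a h q - hcpSite a h p‖)⁻¹) ^ 6 ∧
      |N (decide (Even p.1)) (q - p) s s'| ≤ C₁ * ((1 + ‖hcpSite a h q - hcpSite a h p‖)⁻¹) ^ 6) ∧
      (∀ p ∈ ({(0, 0, 0), (1, 0, 0)} : Finset (ℤ × ℤ × ℤ)), ∀ q : ℤ × ℤ × ℤ, q ∉ QT p → ∀ s s',
      M₁ (decide (Even p.1)) (q - p) s s' = 0 ∧ M₁ (decide (Even q.1)) (p - q) s s' = 0 ∧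
      N (decide (Even p.1)) (q - p) s s' = 0 ∧ N (decide (Even q.1)) (p - q) s' s = 0) ∧
      ∀ p ∈ ({(0, 0, 0), (1, 0, 0)} : Finset (ℤ × ℤ × ℤ)), ∀ V : ℤ × ℤ × ℤ → (Fin 3 → ℝ), V p = 0 →
      (∀ Z : Fin 3 → Fin 3 → ℝ, (∀ j k, Z j k = -Z k j) →
        ∑ q ∈ (if Even p.1 then hcpStarIdx.image (fun d => d + p) else hcpStarIdx.image (fun d => p - d)), ∑ k : Fin 3, V q k * (∑ j : Fin 3, (hcpSite a h q j - hcpSite a h p j) * Z j k) = 0) →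
      0 ≤ p1NearForm a h (1 / 3) (1 / 12) (193 / 125) p p1Stencil (p1Beta a h) M₁ N (p1FarW a h (p1Phi0 p) p) p1SV (p1FarWv a h (p1Phi0 p) p) (fun s => -p1Beta a h (decide (Even p.1)) 0 s) (if Even p.1 then hcpStarIdx.image (fun d => d + p) else hcpStarIdx.image (fun d => p - d)) (p1QB p) (QT p) ∅ (p1FarLegs (p1Phi0 p) p) (fun q => (p1LU p q).1 / ‖hcpSite a h q - hcpSite a h p‖ ^ 2) (fun q => (p1LU p q).2) (p1Paym p) (fun _ => 0) (fun _ _ => 0) V -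
        193 / 125 * p1ExactFluxSum a h p V) :
    CoreJointCoercive a h (1 / 3) (1 / 12) := by
  obtain ⟨hρ1, hρ2⟩ := ratioBox_of_hcpFamilyMin ha hh hfam
  have hlo : 3 / 4 * a ≤ h := by linarith
  refine coreJointCoercive_cell_of_certificates₇ ha hh hfam (fun p hp => ?_) p1QB
    (fun p q => (p1LU p q).1 / ‖hcpSite a h q - hcpSite a h p‖ ^ 2) (fun p q => (p1LU p q).2) (fun p hp q hq hqp z => ?_) hTab
    (fun p hp s hs => payColumn_le_of_near ha hh hfam p s (hPAY p hp s hs)) hNC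
  · -- (B∃) from (B∃_fin, 12a): unloaded cells (`defect_only_budget`), far cells (`farCell_budget12` under the exact rule), the finite rest
    obtain ⟨θ, θv, h1, h2, h3, h4, h5, h6, h7, h8, h9, h10, hX, hfin⟩ := hB p hp
    refine ⟨θ, θv, h1, h2, h3, h4, h5, h6, h7, h8, h9, h10, fun T G => ?_⟩
    by_cases hload : ∃ e, θ e T ≠ 0 ∨ θv e T ≠ 0
    swap
    · push Not at hload
      have e1 : (∑ᶠ e : (ℤ × ℤ × ℤ) × (ℤ × ℤ × ℤ), θ e T * p1FarW a h (p1Phi0 p) p e *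
          fpSq (fun k => (hcpSite a h (e.1 + e.2) 0 - hcpSite a h e.1 0) * G 0 k +
            (hcpSite a h (e.1 + e.2) 1 - hcpSite a h e.1 1) * G 1 k + (hcpSite a h (e.1 + e.2) 2 - hcpSite a h e.1 2) * G 2 k)) = 0 :=
        finsum_eq_zero_of_forall_eq_zero fun e => by rw [(hload e).1, zero_mul, zero_mul]
      have e2 : (∑ᶠ e : (ℤ × ℤ × ℤ) × (ℤ × ℤ × ℤ), θv e T *
            (∑ i : Fin 3, (2 / 3) * ((if e.2 = p1RouteOff e.1 i then p1FarWv a h (p1Phi0 p) p e.1 else 0) +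
              (if p1RouteOff (e.1 - (p1SV - e.2)) i = p1SV - e.2 then p1FarWv a h (p1Phi0 p) p (e.1 - (p1SV - e.2)) else 0))) *
            fpSq (fun k => (hcpSite a h (e.1 + e.2) 0 - hcpSite a h e.1 0) * G 0 k +
              (hcpSite a h (e.1 + e.2) 1 - hcpSite a h e.1 1) * G 1 k + (hcpSite a h (e.1 + e.2) 2 - hcpSite a h e.1 2) * G 2 k)) = 0 :=
        finsum_eq_zero_of_forall_eq_zero fun e => by rw [(hload e).2, zero_mul, zero_mul]
      rw [e1, e2, zero_add, zero_add]
      exact defect_only_budget ha hh (by linarith) (by linarith) p T G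
    by_cases hfar : ∀ m : Fin 4, 12 * a ≤ ‖hcpSite a h (T.1 + p1VertOff (p1Par T.1) T.2 m) - hcpSite a h p‖
    swap
    · have hnear : ∃ m : Fin 4, ‖hcpSite a h (T.1 + p1VertOff (p1Par T.1) T.2 m) - hcpSite a h p‖ < 12 * a := by
        by_contra hc
        exact hfar fun m => not_lt.1 fun hm => hc ⟨m, hm⟩
      have hT : T.1 ∈ p1CellBox12 p := by
        by_contra hT
        obtain ⟨m, hm⟩ := hnear
        exact absurd (far_of_not_mem_cellBox12 ha hlo p T hT (p1Par T.1) m) (not_le.2 hm)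
      exact hfin T hT hnear hload G
    · have hX' := hX T hfar
      have hbud := farCell_budget12 ha hh hfam p T hfar G
      have e1 := finsum_congr (f := fun e : (ℤ × ℤ × ℤ) × (ℤ × ℤ × ℤ) => θ e T * p1FarW a h (p1Phi0 p) p e *
          fpSq (fun k => (hcpSite a h (e.1 + e.2) 0 - hcpSite a h e.1 0) * G 0 k +
            (hcpSite a h (e.1 + e.2) 1 - hcpSite a h e.1 1) * G 1 k + (hcpSite a h (e.1 + e.2) 2 - hcpSite a h e.1 2) * G 2 k))
        (g := fun e => p1ThetaX a h p e T * p1FarW a h (p1Phi0 p) p e *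
          fpSq (fun k => (hcpSite a h (e.1 + e.2) 0 - hcpSite a h e.1 0) * G 0 k +
            (hcpSite a h (e.1 + e.2) 1 - hcpSite a h e.1 1) * G 1 k + (hcpSite a h (e.1 + e.2) 2 - hcpSite a h e.1 2) * G 2 k))
        (fun e => by rw [(hX' e).1])
      have e2 := finsum_congr (f := fun e : (ℤ × ℤ × ℤ) × (ℤ × ℤ × ℤ) => θv e T *
            (∑ i : Fin 3, (2 / 3) * ((if e.2 = p1RouteOff e.1 i then p1FarWv a h (p1Phi0 p) p e.1 else 0) +
              (if p1RouteOff (e.1 - (p1SV - e.2)) i = p1SV - e.2 then p1FarWv a h (p1Phi0 p) p (e.1 - (p1SV - e.2)) else 0))) *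
            fpSq (fun k => (hcpSite a h (e.1 + e.2) 0 - hcpSite a h e.1 0) * G 0 k +
              (hcpSite a h (e.1 + e.2) 1 - hcpSite a h e.1 1) * G 1 k + (hcpSite a h (e.1 + e.2) 2 - hcpSite a h e.1 2) * G 2 k))
        (g := fun e => p1ThetaX a h p e T *
            (∑ i : Fin 3, (2 / 3) * ((if e.2 = p1RouteOff e.1 i then p1FarWv a h (p1Phi0 p) p e.1 else 0) +
              (if p1RouteOff (e.1 - (p1SV - e.2)) i = p1SV - e.2 then p1FarWv a h (p1Phi0 p) p (e.1 - (p1SV - e.2)) else 0))) *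
            fpSq (fun k => (hcpSite a h (e.1 + e.2) 0 - hcpSite a h e.1 0) * G 0 k +
              (hcpSite a h (e.1 + e.2) 1 - hcpSite a h e.1 1) * G 1 k + (hcpSite a h (e.1 + e.2) 2 - hcpSite a h e.1 2) * G 2 k))
        (fun e => by rw [(hX' e).2])
      rw [e1, e2]
      exact hbud
  · -- (S) from (S_fin): the finite box, else `farSite_domination`
    by_cases hbox : q ∈ Finset.Icc (p.1 - 26) (p.1 + 26) ×ˢ (Finset.Icc (p.2.1 - 34) (p.2.1 + 34) ×ˢ Finset.Icc (p.2.2 - 23) (p.2.2 + 23))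
    · by_cases hlt : ‖hcpSite a h q - hcpSite a h p‖ < 20 * a
      · exact hS p hp q hbox hq hqp hlt z
      · exact farSite_domination ha hh hfam p q (not_lt.1 hlt) z
    · exact farSite_domination ha hh hfam p q (twenty_le_of_not_mem_tailBox ha hlo p q hbox) z

end Summit.AtomisticToContinuum.Crystallization.Theorems.StrictSplittingRuleBirth

end
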